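import Mathlib
import HarnessLib
import HarnessLib.Audit
import Summits.CriticalPhenomena.Statement

/-!
Route: PercClusterResistance

# Route PercClusterResistance — infinite resistance to infinity — a linear wall sum makes the
would-be critical cluster recurrent, BLS/GKZ transience at the same p makes it absurd

It suffices to show X = WallSumLinear ∧ ClusterTransient (card counterfactual-cluster-resistance,
its r2 and r4).
(A) WallSumLinear: at p_c(ℤ³) the wall sum m_k := Σ_{x ∈ ∂Λ_k} P(0 ↔ x by an open path inside Λ_k) —
the expected number of
sites of the wall of the box Λ_k = [−k,k]³ joined to its centre INSIDE the box — is at most C·k for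
all k ≥ 1 (predicted ≍ k^0.55).
(T) ClusterTransient: for every p with θ(p) > 0, P_p-a.s. on {0 ↔ ∞} the open subgraph carries a
unit flow from 0 to ∞ of finite
energy, i.e. simple random walk on C(0) is transient (Lyons1983; LyonsPeres2016 Thm 2.11) — the ℤ³
case of LyonsPeres2016
Conjecture 6.44 (Benjamini–Lyons–Schramm 1999), a theorem for p > p_c (GrimmettKestenZhang1993); its
content is the hypothetical
percolating p = p_c. The in-box exit edge sets Π_k = {open ⟨x,y⟩ : x ∈ Λ_k, y ∉ Λ_k, 0 ↔ x inside
Λ_k} are pairwise disjoint cutsets of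
C(0) with |Π_k| ≤ 6·#{x ∈ ∂Λ_k : 0 ↔ x inside Λ_k}, so Nash-Williams turns (A) + θ(p_c) > 0 into
"C(0) has infinite resistance to
infinity with positive probability" (support RecurrentFromWallSum), which (T) at p = p_c forbids.
Lean: `(∃ C : ℝ, ∀ k : ℕ, 1 ≤ k → ∑ x ∈ Literature.Probability.LatticeModels.innerBoundary
(Literature.Probability.LatticeModels.zdGraph 3) (Literature.Probability.LatticeModels.box 3 k),
(Literature.Probability.Percolation.bondPercolation (Literature.Probability.LatticeModels.zdGraph 3)
(Literature.Probability.Percolation.criticalProbI 3)).real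
(Literature.Probability.Percolation.openConnIn ↑(Literature.Probability.LatticeModels.box 3 k) 0 x)
≤ C * k) ∧ (∀ p : unitInterval, 0 < Literature.Probability.Percolation.theta
(Literature.Probability.LatticeModels.zdGraph 3) 0 p → ∀ᵐ ω
∂(Literature.Probability.Percolation.bondPercolation (Literature.Probability.LatticeModels.zdGraph
3) p), ω ∈ Literature.Probability.Percolation.percolatesAt (0 :
Literature.Probability.LatticeModels.Site 3) → ∃ f : Literature.Probability.LatticeModels.Site 3 →
Literature.Probability.LatticeModels.Site 3 → ℝ, (∀ x y, f x y = -f y x) ∧ (∀ x y, f x y ≠ 0 →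
(Literature.Probability.LatticeModels.zdGraph 3).Adj x y ∧ s(x, y) ∈ ω) ∧ (∀ x, x ≠ 0 → ∑ y ∈
(Literature.Probability.LatticeModels.zdGraph 3).neighborFinset x, f x y = 0) ∧ ∑ y ∈
(Literature.Probability.LatticeModels.zdGraph 3).neighborFinset 0, f 0 y = 1 ∧ Summable (fun q :
Literature.Probability.LatticeModels.Site 3 × Literature.Probability.LatticeModels.Site 3 => f q.1
q.2 ^ 2))`

## Assembly
Pure logic, PROVED sorry-free in the planner's Sketch.lean (25 lines): if θ(p_c) ≠ 0 then θ(p_c) >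
0; RecurrentFromWallSum fed with
WallSumLinear gives P_{p_c}(E) > 0 for E = {|C(0)| = ∞} ∩ {no finite-energy flow from 0}, while
ClusterTransient at p = p_c says
exactly that E is P_{p_c}-null (ae_iff + monotonicity of measure); contradiction, so θ(p_c) = 0,
i.e. PercolationContinuityZ3.
NashWilliamsCutsets is the lemma behind RecurrentFromWallSum and is not an antecedent.

Rationale: WHY THIS LINE. Discrete potential theory is imported with an explicit dictionary: transience ⟺ a
finite-energy unit flow to ∞ (Lyons1983,
LyonsPeres2016 Thm 2.11), recurrence ⟸ pairwise disjoint cutsets with Σ|Π_k|⁻¹ = ∞ (Nash-Williams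
1959, LyonsPeres2016 (2.14)), and the
cutsets are supplied by the one unconditional structure theorem at p_c(ℤ³), Barsky–Grimmett–Newman
finiteness/steering at flat
boundaries (BarskyGrimmettNewman1991, Grimmett1999 Thm (7.35)): the exit edges of the IN-BOX cluster
of the centre through the wall of
Λ_k. The would-be critical cluster of a jump world must then be recurrent (if the wall sum is
linear) and transient (if
GrimmettKestenZhang1993 extends to the same p, as LyonsPeres2016 Conj. 6.44 asserts and
Hutchcroft2023 p.5 records as open), so
θ(p_c) = 0. None of the nine route files of this conjunct has a random-walk / electrical item;
ClusterTransient is moreover a hub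
statement wanted by cards necklace-or-conductor (its branch (N1)) and
gamblers-ruin-vs-receding-floor, and relative to
PercLowPointHalfSpace the line trades the boundary two-arm and low-point bookkeeping cruxes for BLS
transience, keeping one boundary
sum (A) of the same family as its TallClusterMassBound. New accounting recorded with the route
(Numbers): boundary-only information
caps cutset sizes at k^(2−x_s) ≈ k^1.03, a hair above the Nash-Williams threshold k^(d−2) = k, so
(A) is exactly the place where a
sliver of bulk thinness must enter — or none, should the surface exponent x_s turn out ≥ 1.

RANKED CRUXES. #2 WallSumLinear (crux) — at p = p_c(ℤ³), for all k ≥ 1, Σ_{x ∈ innerBoundary(Λ_k)}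
P_{p_c}(0 ↔ x by an open path inside Λ_k) ≤ C·k (card item r2 in its weakest sufficient, linear,
form; predicted truth k^(2−x_s−x_h) ≈ k^0.55; the trivial bound is 24k²+2). [difficulty: XL] (why it
might fail: A two-point UPPER bound at p_c in d=3 (none exists). Boundary-only (BGN+BK) information
caps E N_k at k^(2-x_s) ~ k^1.03 (x_s~0.975<1), short of linear: a proof must also get a sliver
k^-0.03 of bulk thinness of tall wall clusters - it is where the jump world dies.)
[BarskyGrimmettNewman1991, Grimmett1999, DengBlote2005, ChatterjeeHanson2020, arXiv:2512.13624,
CerfDembin2020]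
#3 ClusterTransient (crux) — for every p ∈ [0,1] with θ(p) > 0, for P_p-a.e. ω with |C(0)| = ∞ there
is f : ℤ³ × ℤ³ → ℝ antisymmetric, supported on open nearest-neighbour edges, with Kirchhoff's node
law off 0, net out-flow 1 at 0 and Σ f² < ∞ (a finite-energy unit flow 0 → ∞ in the open graph ⟺ SRW
on C(0) transient); LyonsPeres2016 Conj. 6.44 on ℤ³, known for p > p_c (GKZ 1993, Pete 2008),
content = the percolating p_c (card item r4). [difficulty: open-problem] (why it might fail: Every
transience proof (GKZ via Grimmett-Marstrand, BPP paths, Pete/Hutchcroft isoperimetry) needs p>p_c;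
at a percolating p_c, C has p_c(C)=1, finite half-space pieces (BGN), cutsets <~k^1.03 hence
anchored iso-dim<2 (Thomassen unusable); UST hulls show density+uniqueness give no flow.)
[GrimmettKestenZhang1993, LyonsPeres2016, Hutchcroft2023, Pete2008, CerfDembin2020, Thomassen1992,
arXiv:math/9804010]
#9 RecurrentFromWallSum (support) — for every p: (linear wall sum at p) ∧ θ(p) > 0 ⇒ P_p(|C(0)| = ∞
and NO finite-energy unit flow from 0 exists) > 0. Proof (checked on paper): a.s. ω ⊆ E(ℤ³); Π_k :=
{open ⟨x,y⟩: x ∈ Λ_k, y ∉ Λ_k, 0 ↔ x inside Λ_k} are cutsets (first exit edge of any path leaving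
Λ_k) and pairwise disjoint (‖x‖∞ = k), |Π_k| ≤ 6N_k with N_k = #{x ∈ ∂Λ_k : 0 ↔ x inside Λ_k} ≥ 1 on
{0 ↔ ∞}; dyadic blocks B_j = [2^j, 2^(j+1)): E Σ_{B_j} N_k ≤ 2C·4^j, Markov at level (4C/θ)4^j and
reverse Fatou give, with probability ≥ θ/2, {0 ↔ ∞} and infinitely many j with Σ_{B_j} 1/N_k ≥
|B_j|²/Σ_{B_j} N_k ≥ θ/(4C) (Cauchy–Schwarz), so Σ_k |Π_k|⁻¹ = ∞ and NashWilliamsCutsets excludes a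
finite-energy flow. [difficulty: M] [LyonsPeres2016, Lyons1983, GrimmettKestenZhang1993]
#9 NashWilliamsCutsets (support) — deterministic Nash-Williams inequality in flow form on the open
subgraph of any ω ⊆ Sym2(ℤ³): if cut_k (k ∈ ℕ) are pairwise disjoint finite edge sets each
separating 0 from ∞ in ω (the open cluster of 0 in ω ∖ cut_k is finite), then every finite-energy
unit flow f from 0 satisfies Σ_{k<n} |cut_k|⁻¹ ≤ Σ_{(x,y)} f(x,y)² for all n (LyonsPeres2016 (2.14),
PDF p.104; proof: the flux of f out of the finite ω∖cut_k-cluster of 0 is 1 and passes through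
cut_k, then Cauchy–Schwarz; |cut_k| = 0 contributes 0 in Lean and forces vacuity). [difficulty:
provable-now] [LyonsPeres2016, Lyons1983]

TWO-LAYER PLAN. Foreseen glued splits (k ≤ 3, depth 1; nothing filed now). WallSumLinear ⇐
MixedArmBound (π_H(⌊k/2⌋−1)·π(⌊k/2⌋) ≤ C/k at p_c: half-space
one-arm from a face point times bulk one-arm from the centre) → BKWallSplit (van den Berg–Kesten
disjoint occurrence + face/edge/corner
geometry of Λ_k, provable now) → WallSumLinear. ClusterTransient ⇐ SamePPathMeasure (for θ(p) > 0:
a.s. a probability measure on open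
self-avoiding paths 0 → ∞ whose edge marginals are square-summable, built from density + uniqueness
+ insertion tolerance and an
AKN-martingale cluster-repulsion inequality WITHOUT sprinkling, cf. Hutchcroft2023 §1 'About the
proof') → PathsToFlow (LyonsPeres2016 §2.5/§5.5:
such a measure gives a finite-energy unit flow, provable now) → ClusterTransient.
RecurrentFromWallSum ⇐ InBoxExitCutsets (deterministic:
Π_k disjoint cutsets, |Π_k| ≤ 6N_k) → DyadicFatou (Markov + reverse Fatou + Cauchy–Schwarz) →
RecurrentFromWallSum, with NashWilliamsCutsets.

KILL CRITERIA. No refutation of WallSumLinear or ClusterTransient is expected in the real world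
(both are predicted true; ClusterTransient at p_c is
implied by the conjunct). What closes or pivots the route: (i) a refuter showing the dyadic argument
of RecurrentFromWallSum needs MORE than
a linear wall sum — restate WallSumLinear with the needed rate (still predicted with margin 0.45) or
close `refuted:RecurrentFromWallSum`
if no rate ≤ 1 suffices; (ii) numerics (kit, m_k for k ≤ 128 at p = 0.2488) with log-slope of m_k ≥
1 — WallSumLinear dead, close
`refuted:WallSumLinear`; (iii) the surface exponent pinned at x_s ≥ 1 — PIVOT (good news): replace
WallSumLinear by QuantitativeBGN at
rate ≥ 1 (boundary-only), shared with PercLowPointHalfSpace.QuantitativeBGN; (iv)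
PercLowPointHalfSpace's TallClusterMassBound ∧
QuantitativeBGN proved — WallSumLinear becomes a corollary (moot), the route reduces to
ClusterTransient; (v) a proof that BGN-type
information alone forces recurrence of a percolating critical cluster would make ClusterTransient ⟺
the conjunct — then the route is a
reformulation and is closed `superseded`.

NOT DECOMPOSED YET. The BK split of WallSumLinear (MixedArmBound, face/edge/corner bookkeeping), the
engine for ClusterTransient (same-p path measures,
electrical use of insertion tolerance and uniqueness, quantitative cluster repulsion without
sprinkling), the measurability / reverse-Fatou
/ Markov bookkeeping inside RecurrentFromWallSum, the a.s. (rather than positive-probability)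
recurrence upgrade (not needed by the
assembly), and any Literature-side definition of effective resistance (the flow predicate is inlined
in the decls). All are layer-2
children or prover-side `--supports` lemmas, later.

CHEAPEST FALSIFIER. Pin the ordinary-transition surface exponent of 3D percolation against 1: x_s =
2 − y_h1 (DengBlote2005, acq-01316 filed; Grassberger 1992
J. Phys. A 25) — x_s < 1 (current reading ≈ 0.975) means WallSumLinear cannot come from boundary
information alone and must import bulk
thinness (route stays open but XL); x_s ≥ 1 means QuantitativeBGN at its true rate already gives
recurrence (route strengthens). Second:
a kit Monte-Carlo of m_k, k ≤ 128, at p_c(bond ℤ³) = 0.24881 — predicted log-slope ≈ 0.55; a slope ≥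
1 kills WallSumLinear. Neither
run in this session (compute-free hub; remote literature APIs rate-limited, acquisition pending).

NUMBERS. p_c(bond ℤ³) ≈ 0.24881. Bulk: β ≈ 0.418, ν ≈ 0.876, x_h = β/ν ≈ 0.477 = bulk one-arm
exponent (hyperscaling). Surface (ordinary
transition, numerics DengBlote2005): y_h1 ≈ 1.025, x_s = 2 − y_h1 ≈ 0.975 = half-space one-arm
exponent; d = 2: x_s = 1/3 exactly;
mean field (d > 6): x_s = 3, half-space one-arm ≍ n⁻³ vs bulk n⁻² (ChatterjeeHanson2020, d ≥ 11;
sharp half-space two-point bounds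
arXiv:2512.13624). Predicted wall sum m_k ≍ k^(2−x_s−x_h) ≈ k^0.55 (card: k^0.4 with η_⊥ ≈ 0.6);
WallSumLinear asks k^1: margin
≈ 0.45. Nash-Williams threshold on ℤ³-scale cutsets: |Π_k| ≲ k^(d−2) = k (harmonic mean over dyadic
blocks). Boundary-only
(jump-world-valid) cap: E N_k ≲ 24k²·π_H(k/2) ≍ k^(2−x_s) ≈ k^1.03 — misses the threshold by 0.03;
equivalently the surface
susceptibility Σ_{x∈∂ℍ} P(0 ↔_ℍ x) diverges iff x_s < 1. Jump-world anchored cutsets from BGN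
counts: ≲ k^1.03 around Λ_k, so anchored
isoperimetric dimension ≤ 3/(3 − 1.03·1) ≈ 1.5 < 2 (Thomassen1992 needs > 2; CerfDembin2020 Thm 1.2
proves liminf n·φ̂_n(p_c) = 0).
GKZ: d ≥ 3, p > p_c (Grimmett1999 §8 notes, PDF p.244). Items at open: 5 (2 cruxes, 2 supports, 1
assembly).

DEFINITION REQUESTS. None filed. Mathlib/Literature have no effective resistance or
recurrence/transience of a (random) subgraph; the decls inline the
finite-energy unit-flow predicate (antisymmetric, supported on open lattice edges, Kirchhoff off 0,
out-flow 1 at 0, square-summable),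
which by Lyons1983 / LyonsPeres2016 Thm 2.11 IS transience of C(0). A Literature definition
`IsFiniteEnergyUnitFlow` +
`Literature.Probability…effectiveResistanceToInfinity` would shorten
ClusterTransient/NashWilliamsCutsets/RecurrentFromWallSum; the tenure
planner may request it once a prover asks. Cite fact wanted (not load-bearing, T subsumes it):
GrimmettKestenZhang1993 main theorem
(transience of the supercritical cluster, d ≥ 3).

Novelty: Searches (2026-08-15): `lit search --source zbmath "percolation cluster transient random walk"` (12:
GKZ93 doi:10.1007/bf01195881, Berger02,
Pete08, Levin–Peres99 zbl:0957.60097, Häggström–Mossel98 …, all p > p_c or long range); `… zbmath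
"Nash-Williams recurrence percolation"` (1:
McGuinness 1991); `… zbmath "anchored isoperimetric profile percolation critical"` (3:
CerfDembin2020, Dembin ×2); `… zbmath "Transience and
anchored isoperimetric dimension …"` (Hutchcroft2023 doi:10.1214/23-ejp905); `lit search --source s2
"random walk on critical percolation cluster
three dimensions recurrence"` (8: physics numerics only, Sahimi–Jerauld 1983 …); `… s2 "Deng Blote
surface critical phenomena three-dimensional
percolation"` (DengBlote2005); `… s2 "Chatterjee Hanson restricted percolation … half-space"`
(ChatterjeeHanson2020, Panis–Schapira arXiv:2512.13624,
arXiv:2510.21595); `lit search --hybrid "random walk on the infinite percolation cluster transient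
Nash-Williams cutsets recurrence"` (held:
LyonsPeres2016 pp.104–106, 237–240, 314, 423 read; Grimmett2010/2018; Heydenreich–vdHofstad 2017);
`lit galaxy search --star all` ×4
("recurrence of the incipient infinite cluster", "Nash-Williams criterion", "infinite cluster is
transient", "transience of percolation
clusters": 0 rows, panama/pdf queue timeouts); OpenAlex budget exhausted, arXiv API 429 (logged);
the card's and its novelty audit's searches.
Nearest prior art found: GrimmettKestenZhang1993 (transience for p > p_c via Grimme  [refs: 10.1007/bf01195881, 10.1214/23-ejp905, 2512.13624, 2510.21595, math/9804010, doi:10.1007/bf01195881, doi:10.1214/23-ejp905, CerfDembin2020, Hutchcroft2023, DengBlote2005, ChatterjeeHanson2020, LyonsPeres2016, GrimmettKestenZhang1993]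

Barriers (technique_class: effective-resistance, nash-williams, wall-sum, transience): - technique_class: effective-resistance, nash-williams, wall-sum, transience
- Literature.Barriers.CriticalPhenomena.SprinklingRenormalisation: applies head-on to
ClusterTransient — GKZ, Pete and Hutchcroft all certify transience only at p > p_c
(Grimmett–Marstrand blocks or sprinkled cluster repulsion); not evaded: the bet is a same-p flow
from density + uniqueness + insertion tolerance with an AKN-martingale repulsion inequality that
needs no sprinkling (Hutchcroft2023 §1). WallSumLinear and both supports live at p_c(ℤ³) and
renormalise nothing.
- Literature.Barriers.CriticalPhenomena.GaussianDominationRoute: WallSumLinear is a two-point upper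
bound at p_c, but bulk-to-WALL and in-box, governed by x_s + x_h ≈ 1.45 (predicted true with margin)
rather than the bulk infrared bound that EtaNegativePredictionZ3 predicts false (η < 0); no
reflection positivity is used or available. Conceded: it still needs a k^−0.03 sliver of bulk
thinness beyond boundary counting.
- Literature.Barriers.CriticalPhenomena.SubexponentialGrowthZd: transience on ℤ³ cannot come from
growth or branching (amenable, cubic growth; BLS99 handles only the nonamenable case);
ClusterTransient must use density and flows — acknowledged, not evaded.
- Literature.Barriers.CriticalPhenomena.AmenableInvariantPercolation: not engaged — no
cluster-size-blind degree/density threshold is invoked; the assembly needs recurrence only with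
positive probability, so not even the ergodic a.s. upgrade (mass transport) enters.

sub-problem: PercolationContinuityZ3 · status: draft · opened planner-plancard-CriticalPhenomena-Percolatio-33d80131-0 2026-08-15T11:41:42Z · rev 5 · ledger route-CriticalPhenomena-PercClusterResistance
GENERATED by the gate from the ledger (D-0016/17). Provers cite these decls: `theorem foo : Summit.CriticalPhenomena.PercolationContinuityZ3.Theses.PercClusterResistance.<Decl> := …` in Summits/CriticalPhenomena/PercolationContinuityZ3/Theorems/<Name>.lean.
-/

namespace Summit.CriticalPhenomena.PercolationContinuityZ3.Theses.PercClusterResistance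

open scoped BigOperators Topology Manifold Classical MeasureTheory ProbabilityTheory Matrix InnerProductSpace ComplexConjugate ContinuousMap
open Filter Set Function TopologicalSpace MeasureTheory

attribute [summit_statement] _root_.PercolationContinuityZ3

/-- item stmt-CriticalPhenomena-5590 · crux · rank 2 · open · by planner
why it might fail: An UPPER bound on critical connectivities in d=3 (the sum is DCT16's φ_{p_c}(Λ_k) up to a factor in [p_c,3p_c]; only φ ≥ 1 is known, two-point upper bounds need d ≥ 11). False iff x_s+x_h ≤ 1 (numerics 0.975+0.477); boundary-only input (BGN+BK) caps at k^{2−x_s} ≈ k^1.03 > k.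
sources: BarskyGrimmettNewman1991, DuminilCopinTassionEM2016, FitznerVanDerHofstad2017, DengBlote2005, Grimmett1999, ChatterjeeHanson2020
[crux] at p = p_c(ℤ³), for all k ≥ 1, Σ_{x ∈ innerBoundary(Λ_k)} P_{p_c}(0 ↔ x by an open path
inside Λ_k) ≤ C·k (card item r2 in its weakest sufficient, linear, form; predicted truth
k^(2−x_s−x_h) ≈ k^0.55; the trivial bound is 24k²+2). [difficulty: XL] -/
@[route_item "route-CriticalPhenomena-PercClusterResistance"]
def WallSumLinear : Prop :=
  ∃ C : ℝ, ∀ k : ℕ, 1 ≤ k → ∑ x ∈ Literature.Probability.LatticeModels.innerBoundary (Literature.Probability.LatticeModels.zdGraph 3) (Literature.Probability.LatticeModels.box 3 k), (Literature.Probability.Percolation.bondPercolation (Literature.Probability.LatticeModels.zdGraph 3) (Literature.Probability.Percolation.criticalProbI 3)).real (Literature.Probability.Percolation.openConnIn ↑(Literature.Probability.LatticeModels.box 3 k) 0 x) ≤ C * k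

/-- item stmt-CriticalPhenomena-5591 · crux · rank 3 · closed · proved by Summit.CriticalPhenomena.PercolationContinuityZ3.Theorems.ClusterResistanceClusterTransient.clusterTransient_proof @ 1a2588ee967d (prover) · by planner
why it might fail: p>p_c is PROVED in-tree (GrimmettKestenZhang1993_flow_holds); the live case is a percolating p_c: every transience engine (Grimmett–Marstrand seeds, Pete/Hutchcroft isoperimetry) sprinkles, and critical infinite clusters are recurrent where understood (IIC: Kesten86 d=2; Kozma–Nachmias09 high d).
sources: GrimmettKestenZhang1993, LyonsPeres2016, arXiv:math/9804010, Hutchcroft2023, Pete2008, CerfDembin2020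
[crux] for every p ∈ [0,1] with θ(p) > 0, for P_p-a.e. ω with |C(0)| = ∞ there is f : ℤ³ × ℤ³ → ℝ
antisymmetric, supported on open nearest-neighbour edges, with Kirchhoff's node law off 0, net
out-flow 1 at 0 and Σ f² < ∞ (a finite-energy unit flow 0 → ∞ in the open graph ⟺ SRW on C(0)
transient); LyonsPeres2016 Conj. 6.44 on ℤ³, known for p > p_c (GKZ 1993, Pete 2008), content = the
percolating p_c (card item r4). [difficulty: open-problem] -/
@[route_item "route-CriticalPhenomena-PercClusterResistance"]
def ClusterTransient : Prop :=
  ∀ p : unitInterval, 0 < Literature.Probability.Percolation.theta (Literature.Probability.LatticeModels.zdGraph 3) 0 p → ∀ᵐ ω ∂(Literature.Probability.Percolation.bondPercolation (Literature.Probability.LatticeModels.zdGraph 3) p), ω ∈ Literature.Probability.Percolation.percolatesAt (0 : Literature.Probability.LatticeModels.Site 3) → ∃ f : Literature.Probability.LatticeModels.Site 3 → Literature.Probability.LatticeModels.Site 3 → ℝ, (∀ x y, f x y = -f y x) ∧ (∀ x y, f x y ≠ 0 → (Literature.Probability.LatticeModels.zdGraph 3).Adj x y ∧ s(x, y) ∈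 ω) ∧ (∀ x, x ≠ 0 → ∑ y ∈ (Literature.Probability.LatticeModels.zdGraph 3).neighborFinset x, f x y = 0) ∧ ∑ y ∈ (Literature.Probability.LatticeModels.zdGraph 3).neighborFinset 0, f 0 y = 1 ∧ Summable (fun q : Literature.Probability.LatticeModels.Site 3 × Literature.Probability.LatticeModels.Site 3 => f q.1 q.2 ^ 2)

/-- item stmt-CriticalPhenomena-5592 · support · rank 9 · closed · proved by Summit.CriticalPhenomena.PercolationContinuityZ3.Theorems.RecurrentFromWallSum.recurrentFromWallSum_proof @ 4fb0c9affaa0 (prover) · by planner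
sources: LyonsPeres2016, Lyons1983, GrimmettKestenZhang1993
[support] for every p: (linear wall sum at p) ∧ θ(p) > 0 ⇒ P_p(|C(0)| = ∞ and NO finite-energy unit
flow from 0 exists) > 0. Proof (checked on paper): a.s. ω ⊆ E(ℤ³); Π_k := {open ⟨x,y⟩: x ∈ Λ_k, y ∉
Λ_k, 0 ↔ x inside Λ_k} are cutsets (first exit edge of any path leaving Λ_k) and pairwise disjoint
(‖x‖∞ = k), |Π_k| ≤ 6N_k with N_k = #{x ∈ ∂Λ_k : 0 ↔ x inside Λ_k} ≥ 1 on {0 ↔ ∞}; dyadic blocks B_j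
= [2^j, 2^(j+1)): E Σ_{B_j} N_k ≤ 2C·4^j, Markov at level (4C/θ)4^j and reverse Fatou give, with
probability ≥ θ/2, {0 ↔ ∞} and infinitely many j with Σ_{B_j} 1/N_k ≥ |B_j|²/Σ_{B_j} N_k ≥ θ/(4C)
(Cauchy–Schwarz), so Σ_k |Π_k|⁻¹ = ∞ and NashWilliamsCutsets excludes a finite-energy flow.
[difficulty: M] -/
@[route_item "route-CriticalPhenomena-PercClusterResistance"]
def RecurrentFromWallSum : Prop :=
  ∀ p : unitInterval, (∃ C : ℝ, ∀ k : ℕ, 1 ≤ k → ∑ x ∈ Literature.Probability.LatticeModels.innerBoundary (Literature.Probability.LatticeModels.zdGraph 3) (Literature.Probability.LatticeModels.box 3 k), (Literature.Probability.Percolation.bondPercolation (Literature.Probability.LatticeModels.zdGraph 3) p).real (Literature.Probability.Percolation.openConnIn ↑(Literature.Probability.LatticeModels.box 3 k) 0 x) ≤ C * k) → 0 < Literature.Probability.Percolation.theta (Literature.Probability.LatticeModels.zdGraph 3) 0 p → 0 < (Literature.Probability.Percolation.bondPercolation (Literature.Probability.LatticeModels.zdGraph 3) p).real (Literature.Probability.Percolation.percolatesAt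 (0 : Literature.Probability.LatticeModels.Site 3) ∩ {ω | ¬ ∃ f : Literature.Probability.LatticeModels.Site 3 → Literature.Probability.LatticeModels.Site 3 → ℝ, (∀ x y, f x y = -f y x) ∧ (∀ x y, f x y ≠ 0 → (Literature.Probability.LatticeModels.zdGraph 3).Adj x y ∧ s(x, y) ∈ ω) ∧ (∀ x, x ≠ 0 → ∑ y ∈ (Literature.Probability.LatticeModels.zdGraph 3).neighborFinset x, f x y = 0) ∧ ∑ y ∈ (Literature.Probability.LatticeModels.zdGraph 3).neighborFinset 0, f 0 y = 1 ∧ Summable (fun q : Literature.Probability.LatticeModels.Site 3 × Literature.Probability.LatticeModels.Site 3 => f q.1 q.2 ^ 2)})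

/-- item stmt-CriticalPhenomena-5593 · support · rank 9 · closed · proved by Summit.CriticalPhenomena.PercolationContinuityZ3.Theorems.NashWilliams.nashWilliamsCutsets_proof @ b8f2e38e05a3 (prover) · by planner
sources: LyonsPeres2016, Lyons1983
[support] deterministic Nash-Williams inequality in flow form on the open subgraph of any ω ⊆
Sym2(ℤ³): if cut_k (k ∈ ℕ) are pairwise disjoint finite edge sets each separating 0 from ∞ in ω (the
open cluster of 0 in ω ∖ cut_k is finite), then every finite-energy unit flow f from 0 satisfies
Σ_{k<n} |cut_k|⁻¹ ≤ Σ_{(x,y)} f(x,y)² for all n (LyonsPeres2016 (2.14), PDF p.104; proof: the flux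
of f out of the finite ω∖cut_k-cluster of 0 is 1 and passes through cut_k, then Cauchy–Schwarz;
|cut_k| = 0 contributes 0 in Lean and forces vacuity). [difficulty: provable-now] -/
@[route_item "route-CriticalPhenomena-PercClusterResistance"]
def NashWilliamsCutsets : Prop :=
  ∀ (ω : Literature.Probability.Percolation.BondConfig (Literature.Probability.LatticeModels.Site 3)) (cut : ℕ → Finset (Sym2 (Literature.Probability.LatticeModels.Site 3))), (∀ k, (Literature.Probability.Percolation.openCluster (ω \ ↑(cut k)) (0 : Literature.Probability.LatticeModels.Site 3)).Finite) → (Pairwise fun i j => Disjoint (cut i) (cut j)) → ∀ f : Literature.Probability.LatticeModels.Site 3 → Literature.Probability.LatticeModels.Site 3 → ℝ, ((∀ x y, f x y = -f y x) ∧ (∀ x y, f x y ≠ 0 → (Literature.Probability.LatticeModels.zdGraph 3).Adj x y ∧ s(x, y) ∈ ω) ∧ (∀ x, x ≠ 0 → ∑ y ∈ (Literature.Probability.LatticeModels.zdGraph 3).neighborFinset x, f x y = 0) ∧ ∑ y ∈ (Literature.Probability.LatticeModels.zdGraph 3).neighborFinset 0, f 0 y = 1 ∧ Summable (fun q : Literature.Probability.LatticeModels.Site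 3 × Literature.Probability.LatticeModels.Site 3 => f q.1 q.2 ^ 2)) → ∀ n : ℕ, ∑ k ∈ Finset.range n, ((cut k).card : ℝ)⁻¹ ≤ ∑' q : Literature.Probability.LatticeModels.Site 3 × Literature.Probability.LatticeModels.Site 3, f q.1 q.2 ^ 2

/-- item stmt-CriticalPhenomena-5594 · assembly · rank 1 · closed · proved by Summit.CriticalPhenomena.PercolationContinuityZ3.Theorems.PercClusterResistanceAssembly.assembly_proof @ 92bb82197b47 (prover) · by planner
sources: LyonsPeres2016, GrimmettKestenZhang1993, BarskyGrimmettNewman1991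
[assembly] WallSumLinear → ClusterTransient → RecurrentFromWallSum → PercolationContinuityZ3 (θ(p_c)
= 0 on ℤ³). -/
@[route_item "route-CriticalPhenomena-PercClusterResistance"]
def Assembly : Prop :=
  WallSumLinear → ClusterTransient → RecurrentFromWallSum → PercolationContinuityZ3

/-! D-0027 §2.1 — DECIDING THEOREM (planner-authored via `route open/edit --closes-file`; by operator:999:2941348 2026-08-15T15:24:41Z):
its hypotheses are this route's items and its conclusion the sub-problem Statement (glue_lint), and it elaborates with this file. -/

@[closes "route-CriticalPhenomena-PercClusterResistance"] theorem closes : WallSumLinear → ClusterTransient → RecurrentFromWallSum → NashWilliamsCutsets → Assembly → _root_.PercolationContinuityZ3 := fun h_WallSumLinear h_ClusterTransient h_RecurrentFromWallSum h_NashWilliamsCutsets h_Assembly => h_Assembly h_WallSumLinear h_ClusterTransient h_RecurrentFromWallSum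

end Summit.CriticalPhenomena.PercolationContinuityZ3.Theses.PercClusterResistance
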